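import Summits.QuantumFields.YangMills.Theorems.UnitScaleTiltProp7Lane2CyclicHatFamily
import Literature.MathematicalPhysics.QuantumFieldTheory.Balaban1983to89.T3ContinuumYM3Torus
import HarnessLib

/-!
# Route `UnitScaleTilt`, crux «MinimiserStabilityRegPr» (stmt-QuantumFields-19200), E′ ∕ (N06) LANE II «DIVERGENCE RECOVERY AT CURVED `W`» — brick (B6-a), part 3 of 3:
# ★★ THE PARTITION OF UNITY AT SCALE `R = L^s` BLOCKS ON THE MEMBER'S FINE TORUS `Site (F.P K) 0` — existence with every numeral explicit

Cell `ym3-torus`, width seat `ym3-torus-px11` (gen 6); ★★OWNER RULING №23 (c); ★p1 g19 LANE II NAMER WORDS №1∕№3 «(B6) := px11 g6, text per LOCATE fcd9ef01, divisibility in the form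
`R := L^s`, small-torus clause `s < m + n`».  THEOREMS ONLY (0 `def`, 0 `sorry`); `--supports stmt-QuantumFields-19200`, count-neutral.  YM₃ on T³ is a ladder rung (R3), not the
Clay problem; nothing here claims (B6) as a whole, (V3), `hN06`, a stub, the crux, d = 4 or the mass gap.

THE STATEMENT (skeleton v1.3 §5 (B6), first half).  For a member `F`, heights `n < K`, and a scale exponent `s < m + n` (so that `R = L^s` blocks of side `ℓ = L^{K−n}` tile the fine torus
of `2L^{m+K}` sites per direction into `A = 2L^{m+n−s} ≥ 2` patches per direction), there are a finite set of CENTRES `Z ⊂ Site (F.P K) 0` and cutoffs `ζ_c`, `c ∈ Z`, with: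
`0 ≤ ζ_c ≤ 1`; `Σ_{c∈Z} ζ_c = 1` EXACTLY; `ζ_c = 0` for `c ∉ Z`; `ζ_c(x) ≠ 0 ⇒` every coordinate of `x` is within cyclic distance `< Rℓ` of `c` (an open sup-ball = the interior of the box
patch of side `2Rℓ + 1`); at most `8` cutoffs alive at any site; steps `|ζ_c(x ± e_μ) − ζ_c(x)| ≤ (3∕2)(Rℓ)⁻¹`; second differences `|ζ_c(x+e_μ) + ζ_c(x−e_μ) − 2ζ_c(x)| ≤ 6(Rℓ)⁻²`.
CONSTRUCTION: `ζ_c(x) = Π_κ θ_{c_κ}(x_κ)`, the product of the cyclic smoothstep hats of ✓ `…Lane2CyclicHats`∕`…Lane2CyclicHatFamily` at spacing `M = Rℓ` on `ZMod (2L^{m+K}) = ZMod (A·M)`,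
centres on the lattice `(M·ℤ)³`.  Every numeral is explicit, so nothing is ∃-quantified over constants: the statement is trivially uniform in `K`, `n`, `m` and the member.
* §1 the arithmetic of the member (`2L^{m+K} = A·M`, `A ≥ 2`, `M ≥ 1`);
* §2 ★★ `exists_partitionOfUnity` — the displayed existence statement.
The commutator rows at this family are ✓∕⧗ `…Lane2CutoffCommutators` (rows 1–2, any unitary `W`) instantiated at `a = (3∕2)(Rℓ)⁻¹`, `a₂ = 6(Rℓ)⁻²`; row 3 (`Qkc`) is a separate file on `RegPr`.

References: T. Bałaban, CMP 99 (1985) 389–434 [Balaban1985BackgroundPropagators] ((3.100) pp.413–414: the partition of unity `h` at scale `M` and its commutators; (3.23) p.394);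
CMP 96 (1984) 223–250 [Balaban1984PropagatorsII] (p.238).
-/

set_option autoImplicit false

noncomputable section

open scoped BigOperators

namespace Summit.QuantumFields.YangMills.Theorems.Prop7Lane2PartitionOfUnity

open Literature.MathematicalPhysics.QuantumFieldTheory.Balaban1983to89
open Literature.MathematicalPhysics.QuantumFieldTheory.Balaban1983to89.T3ContinuumYM3Torus
open Summit.QuantumFields.YangMills.Theorems.Prop7Lane2CyclicHats
open Finset

variable (F : T3Family) (n K s : ℕ)

/-! ## §1 The member's cycle is `A·M` with `M = L^s·L^{K−n}`, `A = 2L^{m+n−s}` -/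

/-- `2L^{m+K} = (2L^{m+n−s})·(L^s·L^{K−n})` for `n ≤ K`, `s ≤ m + n`. [folklore] -/
theorem sitesPerDir_eq_mul (hnK : n ≤ K) (hs : s ≤ F.m + n) :
    (F.P K).sitesPerDir 0 = (2 * F.L ^ (F.m + n - s)) * (F.L ^ s * F.L ^ (K - n)) := by
  show 2 * F.L ^ (F.m + K - 0) = _
  rw [Nat.sub_zero, mul_assoc, ← pow_add, ← pow_add]
  congr 2
  omega

/-- `2 ≤ A`. [folklore] -/
theorem two_le_A : 2 ≤ 2 * F.L ^ (F.m + n - s) := by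
  have : 1 ≤ F.L ^ (F.m + n - s) := Nat.one_le_pow _ _ (by have := F.hL.2; omega)
  omega

/-- `1 ≤ M`. [folklore] -/
theorem one_le_M : 1 ≤ F.L ^ s * F.L ^ (K - n) := by
  have hL : 0 < F.L := by have := F.hL.2; omega
  exact Nat.one_le_iff_ne_zero.mpr (Nat.mul_ne_zero (pow_ne_zero _ hL.ne') (pow_ne_zero _ hL.ne'))

/-! ## §2 ★★ The partition of unity -/

/-- ★★ **THE PARTITION OF UNITY AT SCALE `R = L^s` BLOCKS** (skeleton v1.3 §5 (B6), first half; every numeral explicit).  For `n < K` and `s < m + n` there are centres `Z` and cutoffs `ζ`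
on the fine torus `Site (F.P K) 0` with: values in `[0,1]`; `Σ_{c∈Z} ζ c x = 1`; `ζ c = 0` off `Z`; `ζ c x ≠ 0 →` each coordinate of `x` lies within cyclic distance `< L^s·L^{K−n}` of `c`'s;
at most `8` alive at any `x`; steps `≤ (3∕2)∕(L^s·L^{K−n})`; second differences `≤ 6∕(L^s·L^{K−n})²`. [cite: Balaban1985BackgroundPropagators, (3.100) p.413] -/
theorem exists_partitionOfUnity (hnK : n < K) (hs : s < F.m + n) :
    ∃ (Z : Finset (Site (F.P K) 0)) (ζ : Site (F.P K) 0 → Site (F.P K) 0 → ℝ),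
      (∀ c x, 0 ≤ ζ c x ∧ ζ c x ≤ 1) ∧
      (∀ x, ∑ c ∈ Z, ζ c x = 1) ∧
      (∀ c, c ∉ Z → ∀ x, ζ c x = 0) ∧
      (∀ c x, ζ c x ≠ 0 → ∀ κ : Fin 3, min (x κ - c κ).val (c κ - x κ).val < F.L ^ s * F.L ^ (K - n)) ∧
      (∀ x, (Z.filter (fun c => ζ c x ≠ 0)).card ≤ 8) ∧
      (∀ c x (μ : Fin 3), |ζ c (x.shift μ) - ζ c x| ≤ 3 / 2 / ((F.L : ℝ) ^ s * (F.L : ℝ) ^ (K - n)) ∧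
        |ζ c (x.unshift μ) - ζ c x| ≤ 3 / 2 / ((F.L : ℝ) ^ s * (F.L : ℝ) ^ (K - n))) ∧
      (∀ c x (μ : Fin 3), |ζ c (x.shift μ) + ζ c (x.unshift μ) - 2 * ζ c x| ≤ 6 / ((F.L : ℝ) ^ s * (F.L : ℝ) ^ (K - n)) ^ 2) := by
  classical
  -- letters
  set M : ℕ := F.L ^ s * F.L ^ (K - n) with hMdef
  set A : ℕ := 2 * F.L ^ (F.m + n - s) with hAdef
  have hM : 1 ≤ M := one_le_M F n K s
  have hA : 2 ≤ A := two_le_A F n s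
  have hN : (F.P K).sitesPerDir 0 = A * M := sitesPerDir_eq_mul F n K s hnK.le hs.le
  have hMR : (M : ℝ) = (F.L : ℝ) ^ s * (F.L : ℝ) ^ (K - n) := by rw [hMdef]; push_cast; ring
  -- the one-dimensional hat at distance `d`
  let H : ℕ → ℝ := fun d => 1 - 3 * (max 0 (min ((d : ℝ) / M) 1)) ^ 2 + 2 * (max 0 (min ((d : ℝ) / M) 1)) ^ 3
  -- the centres and the cutoffs
  let emb : (Fin 3 → ℕ) → Site (F.P K) 0 := fun g κ => (((g κ * M : ℕ)) : ZMod ((F.P K).sitesPerDir 0))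
  have hinj : Set.InjOn emb ↑(Fintype.piFinset fun _ : Fin 3 => Finset.range A) := by
    intro g hg g' hg' h
    rw [Finset.mem_coe, Fintype.mem_piFinset] at hg hg'
    funext κ
    have hκ : emb g κ = emb g' κ := by rw [h]
    have hAκ := Finset.mem_range.mp (hg κ)
    have hAκ' := Finset.mem_range.mp (hg' κ)
    have hlt : g κ * M < (F.P K).sitesPerDir 0 := by rw [hN]; exact Nat.mul_lt_mul_of_pos_right hAκ (by omega)
    have hlt' : g' κ * M < (F.P K).sitesPerDir 0 := by rw [hN]; exact Nat.mul_lt_mul_of_pos_right hAκ' (by omega)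
    have hv := congrArg ZMod.val hκ
    simp only [emb, ZMod.val_cast_of_lt hlt, ZMod.val_cast_of_lt hlt'] at hv
    exact Nat.eq_of_mul_eq_mul_right (by omega) hv
  let Z : Finset (Site (F.P K) 0) := (Fintype.piFinset fun _ : Fin 3 => Finset.range A).image emb
  let ζ : Site (F.P K) 0 → Site (F.P K) 0 → ℝ := fun c x =>
    if c ∈ Z then ∏ κ : Fin 3, H (min (x κ - c κ).val (c κ - x κ).val) else 0
  have hH01 : ∀ d, 0 ≤ H d ∧ H d ≤ 1 := fun d => hat_mem d
  have hprod01 : ∀ c x : Site (F.P K) 0, 0 ≤ ∏ κ : Fin 3, H (min (x κ - c κ).val (c κ - x κ).val) ∧ ∏ κ : Fin 3, H (min (x κ - c κ).val (c κ - x κ).val) ≤ 1 :=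
    fun c x => ⟨Finset.prod_nonneg fun κ _ => (hH01 _).1, Finset.prod_le_one (fun κ _ => (hH01 _).1) fun κ _ => (hH01 _).2⟩
  refine ⟨Z, ζ, ?_, ?_, ?_, ?_, ?_, ?_, ?_⟩
  -- values in `[0,1]`
  · intro c x
    simp only [ζ]
    split_ifs
    · exact hprod01 c x
    · exact ⟨le_rfl, zero_le_one⟩
  -- sum to one
  · intro x
    have hZ : ∀ c ∈ Z, ζ c x = ∏ κ : Fin 3, H (min (x κ - c κ).val (c κ - x κ).val) := fun c hc => by simp only [ζ, if_pos hc]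
    rw [Finset.sum_congr rfl hZ]
    simp only [Z]
    rw [Finset.sum_image hinj]
    show ∑ g ∈ Fintype.piFinset (fun _ : Fin 3 => Finset.range A), ∏ κ : Fin 3,
        H (min (x κ - (((g κ * M : ℕ)) : ZMod ((F.P K).sitesPerDir 0))).val ((((g κ * M : ℕ)) : ZMod ((F.P K).sitesPerDir 0)) - x κ).val) = 1
    have hps := Finset.sum_prod_piFinset (Finset.range A)
      (fun (κ : Fin 3) (a : ℕ) => H (min (x κ - ((a * M : ℕ) : ZMod ((F.P K).sitesPerDir 0))).val ((((a * M : ℕ) : ZMod ((F.P K).sitesPerDir 0))) - x κ).val))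
    rw [hps]
    exact Finset.prod_eq_one fun κ _ => sum_hats_eq_one hN hA hM (x κ)
  -- zero off `Z`
  · intro c hc x
    simp only [ζ, if_neg hc]
  -- support
  · intro c x hne κ
    simp only [ζ] at hne
    split_ifs at hne with hc
    · exact lt_of_hat_ne_zero hM (Finset.prod_ne_zero_iff.mp hne κ (Finset.mem_univ κ))
    · exact absurd rfl hne
  -- at most eight alive
  · intro x
    have hsub : Z.filter (fun c => ζ c x ≠ 0) ⊆ (Fintype.piFinset fun κ : Fin 3 => (Finset.range A).filter
        (fun a => H (min (x κ - ((a * M : ℕ) : ZMod ((F.P K).sitesPerDir 0))).val ((((a * M : ℕ) : ZMod ((F.P K).sitesPerDir 0))) - x κ).val) ≠ 0)).image emb := by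
      intro c hc
      rw [Finset.mem_filter] at hc
      obtain ⟨hcZ, hne⟩ := hc
      simp only [ζ, if_pos hcZ] at hne
      obtain ⟨g, hg, rfl⟩ := Finset.mem_image.mp hcZ
      refine Finset.mem_image.mpr ⟨g, ?_, rfl⟩
      rw [Fintype.mem_piFinset] at hg ⊢
      intro κ
      exact Finset.mem_filter.mpr ⟨hg κ, Finset.prod_ne_zero_iff.mp hne κ (Finset.mem_univ κ)⟩
    refine (Finset.card_le_card hsub).trans (Finset.card_image_le.trans ?_)
    rw [Fintype.card_piFinset]
    calc ∏ κ : Fin 3, ((Finset.range A).filter (fun a => H (min (x κ - ((a * M : ℕ) : ZMod ((F.P K).sitesPerDir 0))).val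
            ((((a * M : ℕ) : ZMod ((F.P K).sitesPerDir 0))) - x κ).val) ≠ 0)).card
        ≤ ∏ _κ : Fin 3, 2 := Finset.prod_le_prod' fun κ _ => card_hats_ne_zero_le_two hN hA hM (x κ)
      _ = 8 := by norm_num
  -- steps
  · intro c x μ
    by_cases hc : c ∈ Z
    · simp only [ζ, if_pos hc]
      have hsplit : ∀ y : Site (F.P K) 0, ∏ κ : Fin 3, H (min (y κ - c κ).val (c κ - y κ).val)
          = (∏ κ ∈ Finset.univ.erase μ, H (min (y κ - c κ).val (c κ - y κ).val)) * H (min (y μ - c μ).val (c μ - y μ).val) :=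
        fun y => (Finset.prod_erase_mul _ _ (Finset.mem_univ μ)).symm
      have hrest : ∀ y : Site (F.P K) 0, (∀ κ, κ ≠ μ → y κ = x κ) →
          ∏ κ ∈ Finset.univ.erase μ, H (min (y κ - c κ).val (c κ - y κ).val) = ∏ κ ∈ Finset.univ.erase μ, H (min (x κ - c κ).val (c κ - x κ).val) :=
        fun y hy => Finset.prod_congr rfl fun κ hκ => by rw [hy κ (Finset.ne_of_mem_erase hκ)]
      have hP0 : 0 ≤ ∏ κ ∈ Finset.univ.erase μ, H (min (x κ - c κ).val (c κ - x κ).val) := Finset.prod_nonneg fun κ _ => (hH01 _).1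
      have hP1 : ∏ κ ∈ Finset.univ.erase μ, H (min (x κ - c κ).val (c κ - x κ).val) ≤ 1 :=
        Finset.prod_le_one (fun κ _ => (hH01 _).1) fun κ _ => (hH01 _).2
      have hsh : ∀ κ, κ ≠ μ → (x.shift μ) κ = x κ := fun κ hκ => Function.update_of_ne hκ _ _
      have hush : ∀ κ, κ ≠ μ → (x.unshift μ) κ = x κ := fun κ hκ => Function.update_of_ne hκ _ _
      have hshμ : (x.shift μ) μ = x μ + 1 := Function.update_self _ _ _
      have hushμ : (x.unshift μ) μ = x μ - 1 := Function.update_self _ _ _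
      obtain ⟨hstepP, hstepM⟩ := abs_hat_step_le hN hA hM (c μ) (x μ)
      rw [hsplit (x.shift μ), hsplit (x.unshift μ), hsplit x, hrest _ hsh, hrest _ hush, hshμ, hushμ, ← mul_sub, ← mul_sub, abs_mul, abs_mul,
        abs_of_nonneg hP0, ← hMR]
      constructor
      · calc _ ≤ 1 * (3 / 2 / (M : ℝ)) := mul_le_mul hP1 hstepP (abs_nonneg _) zero_le_one
          _ = _ := one_mul _
      · calc _ ≤ 1 * (3 / 2 / (M : ℝ)) := mul_le_mul hP1 hstepM (abs_nonneg _) zero_le_one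
          _ = _ := one_mul _
    · simp only [ζ, if_neg hc, sub_zero, abs_zero]
      constructor <;> positivity
  -- second differences
  · intro c x μ
    by_cases hc : c ∈ Z
    · simp only [ζ, if_pos hc]
      have hsplit : ∀ y : Site (F.P K) 0, ∏ κ : Fin 3, H (min (y κ - c κ).val (c κ - y κ).val)
          = (∏ κ ∈ Finset.univ.erase μ, H (min (y κ - c κ).val (c κ - y κ).val)) * H (min (y μ - c μ).val (c μ - y μ).val) :=
        fun y => (Finset.prod_erase_mul _ _ (Finset.mem_univ μ)).symm
      have hrest : ∀ y : Site (F.P K) 0, (∀ κ, κ ≠ μ → y κ = x κ) →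
          ∏ κ ∈ Finset.univ.erase μ, H (min (y κ - c κ).val (c κ - y κ).val) = ∏ κ ∈ Finset.univ.erase μ, H (min (x κ - c κ).val (c κ - x κ).val) :=
        fun y hy => Finset.prod_congr rfl fun κ hκ => by rw [hy κ (Finset.ne_of_mem_erase hκ)]
      have hP0 : 0 ≤ ∏ κ ∈ Finset.univ.erase μ, H (min (x κ - c κ).val (c κ - x κ).val) := Finset.prod_nonneg fun κ _ => (hH01 _).1
      have hP1 : ∏ κ ∈ Finset.univ.erase μ, H (min (x κ - c κ).val (c κ - x κ).val) ≤ 1 :=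
        Finset.prod_le_one (fun κ _ => (hH01 _).1) fun κ _ => (hH01 _).2
      have hsh : ∀ κ, κ ≠ μ → (x.shift μ) κ = x κ := fun κ hκ => Function.update_of_ne hκ _ _
      have hush : ∀ κ, κ ≠ μ → (x.unshift μ) κ = x κ := fun κ hκ => Function.update_of_ne hκ _ _
      have hshμ : (x.shift μ) μ = x μ + 1 := Function.update_self _ _ _
      have hushμ : (x.unshift μ) μ = x μ - 1 := Function.update_self _ _ _
      have hsec := abs_hat_second_le hN hA hM (c μ) (x μ)
      rw [hsplit (x.shift μ), hsplit (x.unshift μ), hsplit x, hrest _ hsh, hrest _ hush, hshμ, hushμ]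
      set P := ∏ κ ∈ Finset.univ.erase μ, H (min (x κ - c κ).val (c κ - x κ).val)
      rw [show P * H (min (x μ + 1 - c μ).val (c μ - (x μ + 1)).val) + P * H (min (x μ - 1 - c μ).val (c μ - (x μ - 1)).val)
          - 2 * (P * H (min (x μ - c μ).val (c μ - x μ).val))
          = P * (H (min (x μ + 1 - c μ).val (c μ - (x μ + 1)).val) + H (min (x μ - 1 - c μ).val (c μ - (x μ - 1)).val)
              - 2 * H (min (x μ - c μ).val (c μ - x μ).val)) by ring, abs_mul, abs_of_nonneg hP0, ← hMR]
      calc _ ≤ 1 * (6 / (M : ℝ) ^ 2) := mul_le_mul hP1 hsec (abs_nonneg _) zero_le_one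
        _ = _ := one_mul _
    · simp only [ζ, if_neg hc, mul_zero, add_zero, sub_zero, abs_zero]
      positivity

end Summit.QuantumFields.YangMills.Theorems.Prop7Lane2PartitionOfUnity

end
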